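import Summits.QuantumFields.BalabanUV.Beta.D1BFx.TorusGhostWordArrays

/-!
# TB4-W PART 3b-gh (FILE B2) — the PAIR ghost stencils on `ℤ⁴` and products of two arrays (road «BF-x», slot (K))

Sequel of `TorusGhostWordArrays` (owner ruling ρ-g7-1 (1), journal l.24670). The MIXED second-order site words of `KGhostTerm` §3 —
`Mjet₁₁ b b′ · D̂` and the four-term `(L̂²)_{bb′} = Ljet₁₁ L̂ + Ljet_b Ljet_b′ + Ljet_b′ Ljet_b + L̂ Ljet₁₁` — are products of TWO bond-localised
factors; this file supplies the `ℤ⁴` side: the fixed pair stencils `Lgh₂ κ u l u′`, `Xgh₂ κ u l u′` (the `𝒲`-slot of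
`TorusTraceTadpole.tendsto_hessT_hessKer`), their localisation and covariance, and the torus product rule for two arrays. The torus
identities themselves are in the sequel `TorusGhostPairArrays`.

CONTENT (`σ := siteOf 4 s`, `β = (u, κ)`, `β′ = (u′, l)`):
* §1 `perT`∕`arr` on `−K` and `0`; `|s·n|₁ = s|n|₁`; the WINDOW INJECTIVITY `σu = σu′ ∧ |u − u′|₁ < s ⟹ u = u′` and the torus test
  `[(σu, κ) = (σu′, l)] = [u = u′ ∧ κ = l]` for `|u − u′|₁ < s`.
* §2 **PRODUCTS OF TWO ARRAYS**: `perT (arr X) · perT (arr Y) = perT (arr (X ∘ arr s Y))` (every `s`; TA2 `comp_arr_arr` re-indexed) and, for stencils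
  SUPPORTED in the unit balls at `u`, `u′`, `X ∘ arr s Y = X ∘ Y` as soon as `|u − u′|₁ + 3 ≤ s` (only the image `t = 0` meets the support) — hence
  `perT (arr X) · perT (arr Y) = perT (arr (X ∘ Y))` on all large tori.
* §3 the stencils [our objects] `gh₂ κ u := −(ptPair u (u+e) + ptPair (u+e) u)` (table of `Ljet₂`),
  `Lgh₂ κ u l u′ := [β = β′]·(gh₂ ∘ lapU + lapU ∘ gh₂) + ghCur_β ∘ ghCur_β′ + ghCur_β′ ∘ ghCur_β`,
  `Xgh₂ κ u l u′ := [β = β′]·(gh₂ ∘ lapU + lapU ∘ etD_β) − (ghCur_β ∘ etD_β′ + ghCur_β′ ∘ etD_β)`; supports of `ghCur`, `etD`; re-centring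
  `BiLoc K q p ⟹ BiLoc K p q`; `BiLoc (Xgh₂ κ u l u′) u u′ (cD + cC + cC·e^{|u−u′|₁}) (1/2)`, `BiLoc (Lgh₂ …) u u′ (…) (1/2)` — ONE common rate `1/2`
  (shared with the first-order families `Xgh`, `Lgh` of FILE B1); joint covariance `Xgh₂ κ (u+v) l (u′+v) = shiftK (−v) (Xgh₂ κ u l u′)`.

[folklore] finite-stencil algebra + TA2 array calculus; the definitions assert nothing.
-/

noncomputable section

namespace Summit.QuantumFields.BalabanUV.Beta.D1BFx.TorusGhostPairStencils

open Matrix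
open scoped BigOperators
open Literature.MathematicalPhysics.QuantumFieldTheory.Balaban1983to89
open Literature.MathematicalPhysics.QuantumFieldTheory.Balaban1983to89.Beta
open B12Sec2to5 (l1 l1_nonneg)
open ExpKernelCalculus (MKer BiLoc Decays Zl comp shiftK comp_shiftK biLoc_comp_decays biLoc_comp_biLoc)
open AffineAveraging (unitVec)
open KernelWard (biLoc_add biLoc_sub)
open SecondOrderResponse (biLoc_neg)
open BalabanStepJetsSucc (biLoc_comp_right)
open StepJetData (l1_add_le)
open Summit.QuantumFields.BalabanUV.Beta.D1BFx.PeriodicArrays (arr toF toF_apply arr_imageShift decays_arr summable_arr_term)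
open Summit.QuantumFields.BalabanUV.Beta.D1BFx.FibredPeriodisation (periodiseF periodiseF_apply)
open Summit.QuantumFields.BalabanUV.Beta.D1BFx.GhostStencil (ghCur ghCur_apply biLoc_ghCur ghCur_translate biLoc_ghCnt l1_zero l1_unitVec unitVec_ne_zero)
open Summit.QuantumFields.BalabanUV.Beta.D1BFx.PeriodisedProjector (Lhat)
open Summit.QuantumFields.BalabanUV.Beta.D1BFx.TorusHodgeWeight (Dhat Dhat_transpose_mul_Dhat)
open Summit.QuantumFields.BalabanUV.Beta.D1BFx.TorusCoframeJets (Djet Ljet Ljet₂ Ljet₁₁ Mjet₁₁ Ljet₁₁_self Ljet₁₁_of_ne)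
open Summit.QuantumFields.BalabanUV.Beta.D1BFx.TorusJetArrays (ptPair ptPair_apply biLoc_ptPair Ljet₂_eq_arr)
open Summit.QuantumFields.BalabanUV.Beta.D1BFx.TorusGhostWordArrays (perT perT_apply perT_apply_tsum perT_add perT_sub summable_row_arr arr_add arr_sub
  perT_arr_mul_perT lapU decays_lapU shiftK_lapU lapU_imageShift etD etD_apply biLoc_hop biLoc_etD etD_translate ptPair_translate shiftK_add shiftK_sub
  Ljet_eq_perT transpose_Djet_mul_Dhat_eq_perT Ljet_mul_Lhat Lhat_mul_Ljet Lhat_mul_transpose_Djet_mul_Dhat)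

variable (s : ℕ) [NeZero s]

/-! ## §1 More linear algebra; the window injectivity and the torus test -/

section Linear

variable {K V : MKer 4 Unit} {p q : Fin 4 → ℤ} {C δ : ℝ}

/-- [folklore] `perT (−K) = −perT K`. -/
theorem perT_neg (K : MKer 4 Unit) : perT s (-K) = -perT s K := by
  ext x z
  rw [Matrix.neg_apply, perT_apply_tsum, perT_apply_tsum]
  exact tsum_neg

/-- [folklore] `perT 0 = 0`. -/
theorem perT_zero : perT s (0 : MKer 4 Unit) = 0 := by
  ext x z
  rw [Matrix.zero_apply, perT_apply_tsum]
  exact tsum_zero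

omit [NeZero s] in
/-- [folklore] `arr (−V) = −arr V`. -/
theorem arr_neg (V : MKer 4 Unit) : arr s (-V) = -arr s V := by
  funext x y a b
  exact tsum_neg

omit [NeZero s] in
/-- [folklore] `arr 0 = 0`. -/
theorem arr_zero : arr s (0 : MKer 4 Unit) = 0 := by
  funext x y a b
  exact tsum_zero

/-- [folklore] The zero kernel is bi-localised anywhere with any nonnegative constant. -/
theorem biLoc_zero_of_nonneg (p q : Fin 4 → ℤ) (hC : 0 ≤ C) (δ : ℝ) : BiLoc (0 : MKer 4 Unit) p q C δ := by
  intro x y a b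
  rw [Pi.zero_apply, Pi.zero_apply, Pi.zero_apply, Pi.zero_apply, abs_zero]
  positivity

omit [NeZero s] in
/-- [folklore] `|s·n|₁ = s·|n|₁`. -/
theorem l1_natCast_smul (n : Fin 4 → ℤ) : l1 ((s : ℤ) • n) = (s : ℝ) * l1 n := by
  unfold B12Sec2to5.l1
  rw [Finset.mul_sum]
  refine Finset.sum_congr rfl fun i _ => ?_
  rw [Pi.smul_apply, smul_eq_mul, Int.cast_mul, Int.cast_natCast, abs_mul, abs_of_nonneg (Nat.cast_nonneg s)]

/-- [folklore] **WINDOW INJECTIVITY**: two `ℤ⁴` points with the same torus image and `|u − u′|₁ < s` coincide. -/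
theorem eq_of_siteOf_eq {u u' : Fin 4 → ℤ} (h : siteOf 4 s u = siteOf 4 s u') (hs : l1 (u - u') < s) : u = u' := by
  obtain ⟨m', hm'⟩ := exists_eq_imageShift_of_siteOf_eq (rfl : siteOf 4 s u' = siteOf 4 s u')
  obtain ⟨m, hm⟩ := exists_eq_imageShift_of_siteOf_eq h
  set w := windowMap 4 s (siteOf 4 s u')
  have e : u - u' = (s : ℤ) • (m - m') := by
    rw [hm, hm', PeriodicArrays.imageShift_eq_add_smul, PeriodicArrays.imageShift_eq_add_smul, smul_sub]; abel
  rw [e, l1_natCast_smul] at hs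
  by_contra hne
  have hmm : m - m' ≠ 0 := fun h0 => hne (by rw [← sub_eq_zero, e, h0, smul_zero])
  have h1 : (1 : ℝ) ≤ l1 (m - m') := one_le_l1_of_ne_zero hmm
  have hs0 : (0 : ℝ) ≤ s := Nat.cast_nonneg s
  nlinarith

/-- [folklore] **THE TORUS TEST IS THE `ℤ⁴` TEST** for `|u − u′|₁ < s`: `[(σu, κ) = (σu′, l)] = [u = u′ ∧ κ = l]`. -/
theorem torus_test_iff {u u' : Fin 4 → ℤ} (κ l : Fin 4) (hs : l1 (u - u') < s) :
    (siteOf 4 s u, κ) = (siteOf 4 s u', l) ↔ u = u' ∧ κ = l := by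
  constructor
  · intro h
    exact ⟨eq_of_siteOf_eq s (congrArg Prod.fst h) hs, congrArg Prod.snd h⟩
  · rintro ⟨rfl, rfl⟩; rfl

end Linear

/-! ## §2 Products of two arrays -/

section TwoArrays

variable {X Y : MKer 4 Unit} {u u' : Fin 4 → ℤ} {C δ C' δ' : ℝ}

/-- [folklore] **TWO ARRAYS ON THE TORUS** (every `s`): `perT (arr X) · perT (arr Y) = perT (arr (X ∘ arr s Y))` (the right array is a decaying jointly
periodic leg; TA2 `comp_arr_arr` re-indexed). -/
theorem perT_arr_mul_perT_arr (hX : BiLoc X u u C δ) (hδ : 0 < δ) (hY : BiLoc Y u' u' C' δ') (hδ' : 0 < δ') :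
    perT s (arr s X) * perT s (arr s Y) = perT s (arr s (comp X (arr s Y))) :=
  perT_arr_mul_perT s (decays_arr hY hδ' s) (half_pos hδ') (fun x y t a b => arr_imageShift s Y x y t a b) hX hδ

omit [NeZero s] in
/-- [folklore] **NO WRAP-AROUND FOR LARGE TORI**: if `X` is supported in `{|x − u|₁ ≤ 1, |y − u|₁ ≤ 1}`, `Y` in the unit ball at `u′`, and
`|u − u′|₁ + 3 ≤ s`, then `X ∘ arr s Y = X ∘ Y` on `ℤ⁴` (only the image `t = 0` of `Y` meets the support of `X`). -/
theorem comp_arr_eq_comp (hX : ∀ x y a b, X x y a b ≠ 0 → l1 (x - u) ≤ 1 ∧ l1 (y - u) ≤ 1)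
    (hY : ∀ x y a b, Y x y a b ≠ 0 → l1 (x - u') ≤ 1 ∧ l1 (y - u') ≤ 1) (hs : l1 (u - u') + 3 ≤ s) :
    comp X (arr s Y) = comp X Y := by
  funext x z a b
  unfold ExpKernelCalculus.comp
  refine tsum_congr fun y => Finset.sum_congr rfl fun f _ => ?_
  by_cases hx : X x y a f = 0
  · rw [hx, zero_mul, zero_mul]
  · congr 1
    show ∑' t : Fin 4 → ℤ, Y (imageShift s y t) (imageShift s z t) f b = Y y z f b
    have hy : l1 (y - u) ≤ 1 := (hX x y a f hx).2
    rw [tsum_eq_single 0 fun t ht => ?_, imageShift_zero, imageShift_zero]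
    by_contra hne
    have h1 : l1 (imageShift s y t - u') ≤ 1 := (hY _ _ f b hne).1
    have e : (s : ℤ) • t = (imageShift s y t - u') - (y - u') := by rw [PeriodicArrays.imageShift_eq_add_smul]; abel
    have h2 : l1 ((s : ℤ) • t) ≤ l1 (imageShift s y t - u') + l1 (y - u') := by
      rw [e, sub_eq_add_neg _ (y - u')]
      have h := l1_add_le (imageShift s y t - u') (-(y - u')); rwa [Beta.l1_neg] at h
    have h3 : l1 (y - u') ≤ l1 (y - u) + l1 (u - u') := by
      have := l1_add_le (y - u) (u - u'); rwa [sub_add_sub_cancel] at this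
    have h4 : (1 : ℝ) ≤ l1 t := one_le_l1_of_ne_zero ht
    have h5 : (s : ℝ) ≤ (s : ℝ) * l1 t := by nlinarith [Nat.cast_nonneg (α := ℝ) s]
    rw [l1_natCast_smul] at h2
    linarith

/-- [folklore] **TWO STENCIL ARRAYS ON A LARGE TORUS**: `perT (arr X) · perT (arr Y) = perT (arr (X ∘ Y))` for `|u − u′|₁ + 3 ≤ s`. -/
theorem perT_arr_mul_perT_arr_of_le (hXl : BiLoc X u u C δ) (hδ : 0 < δ) (hYl : BiLoc Y u' u' C' δ') (hδ' : 0 < δ')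
    (hX : ∀ x y a b, X x y a b ≠ 0 → l1 (x - u) ≤ 1 ∧ l1 (y - u) ≤ 1)
    (hY : ∀ x y a b, Y x y a b ≠ 0 → l1 (x - u') ≤ 1 ∧ l1 (y - u') ≤ 1) (hs : l1 (u - u') + 3 ≤ s) :
    perT s (arr s X) * perT s (arr s Y) = perT s (arr s (comp X Y)) := by
  rw [perT_arr_mul_perT_arr s hXl hδ hYl hδ', comp_arr_eq_comp s hX hY hs]

end TwoArrays

/-! ## §3 The pair stencils on `ℤ⁴` -/

section Stencils

variable (κ : Fin 4) (u : Fin 4 → ℤ) (l : Fin 4) (u' : Fin 4 → ℤ)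

/-- [our object] **THE TABLE OF `Ljet₂`**: `gh₂ κ u := −([x = u][z = u + e_κ] + [x = u + e_κ][z = u])` (minus the symmetric hop across the bond).
A definition; asserts nothing. -/
def gh₂ : MKer 4 Unit := -(ptPair u (u + unitVec κ) + ptPair (u + unitVec κ) u)

/-- [our object] **THE PAIR TABLE OF `(L̂²)_{bb′}`**:
`Lgh₂ κ u l u′ := [β = β′]·(gh₂ ∘ lapU + lapU ∘ gh₂) + ghCur_β ∘ ghCur_β′ + ghCur_β′ ∘ ghCur_β`. A definition; asserts nothing. -/
def Lgh₂ : MKer 4 Unit :=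
  (if u = u' ∧ κ = l then comp (gh₂ κ u) lapU + comp lapU (gh₂ κ u) else 0)
    + (comp (ghCur κ u) (ghCur l u') + comp (ghCur l u') (ghCur κ u))

/-- [our object] **THE PAIR TABLE OF THE GHOST WORD `Mjet₁₁ b b′ · D̂`**:
`Xgh₂ κ u l u′ := [β = β′]·(gh₂ ∘ lapU + lapU ∘ etD_β) − (ghCur_β ∘ etD_β′ + ghCur_β′ ∘ etD_β)`. A definition; asserts nothing. -/
def Xgh₂ : MKer 4 Unit :=
  (if u = u' ∧ κ = l then comp (gh₂ κ u) lapU + comp lapU (etD κ u) else 0)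
    - (comp (ghCur κ u) (etD l u') + comp (ghCur l u') (etD κ u))

/-- [our object] Unfolding `gh₂`. -/
theorem gh₂_apply (x z : Fin 4 → ℤ) (a b : Unit) :
    gh₂ κ u x z a b = -((if x = u ∧ z = u + unitVec κ then (1 : ℝ) else 0) + (if x = u + unitVec κ ∧ z = u then (1 : ℝ) else 0)) := rfl

/-- [folklore] LOCALISATION of the reversed hop `ptPair u (u + e_κ)` at `(u, u)`: constant `e^{δ}`. -/
theorem biLoc_hop' (δ : ℝ) : BiLoc (ptPair u (u + unitVec κ)) u u (Real.exp δ) δ := by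
  intro x z a b
  rw [ptPair_apply]
  by_cases h : x = u ∧ z = u + unitVec κ
  · obtain ⟨hx, hz⟩ := h
    rw [if_pos ⟨hx, hz⟩, abs_one, hx, hz, add_sub_cancel_left, sub_self, l1_unitVec, l1_zero, zero_add, mul_one, ← Real.exp_add,
      add_neg_cancel, Real.exp_zero]
  · rw [if_neg h, abs_zero]; positivity

/-- [folklore] LOCALISATION of `gh₂` at `(u, u)`: constant `2e^{δ}` (every real `δ`). -/
theorem biLoc_gh₂ (δ : ℝ) : BiLoc (gh₂ κ u) u u (Real.exp δ + Real.exp δ) δ := biLoc_neg (biLoc_add (biLoc_hop' κ u δ) (biLoc_hop κ u δ))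

/-- [folklore] SUPPORT of the current: inside the unit balls at `u`. -/
theorem ghCur_support (x y : Fin 4 → ℤ) (a b : Unit) (h : ghCur κ u x y a b ≠ 0) : l1 (x - u) ≤ 1 ∧ l1 (y - u) ≤ 1 := by
  rw [ghCur_apply] at h
  by_cases hA : x = u + unitVec κ ∧ y = u
  · obtain ⟨rfl, rfl⟩ := hA
    rw [add_sub_cancel_left, sub_self, l1_unitVec, l1_zero]; exact ⟨le_rfl, zero_le_one⟩
  · by_cases hB : x = u ∧ y = u + unitVec κ
    · obtain ⟨rfl, rfl⟩ := hB
      rw [add_sub_cancel_left, sub_self, l1_unitVec, l1_zero]; exact ⟨zero_le_one, le_rfl⟩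
    · rw [if_neg hA, if_neg hB, sub_zero] at h; exact absurd rfl h

/-- [folklore] SUPPORT of `etD`: inside the unit balls at `u`. -/
theorem etD_support (x y : Fin 4 → ℤ) (a b : Unit) (h : etD κ u x y a b ≠ 0) : l1 (x - u) ≤ 1 ∧ l1 (y - u) ≤ 1 := by
  rw [etD_apply] at h
  by_cases hA : x = u + unitVec κ ∧ y = u + unitVec κ
  · obtain ⟨rfl, rfl⟩ := hA
    rw [add_sub_cancel_left, l1_unitVec]; exact ⟨le_rfl, le_rfl⟩
  · by_cases hB : x = u + unitVec κ ∧ y = u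
    · obtain ⟨rfl, rfl⟩ := hB
      rw [add_sub_cancel_left, sub_self, l1_unitVec, l1_zero]; exact ⟨le_rfl, zero_le_one⟩
    · rw [if_neg hA, if_neg hB, sub_zero] at h; exact absurd rfl h

/-- [folklore] **RE-CENTRING**: a kernel bi-localised at `(q, p)` is bi-localised at `(p, q)` with the factor `e^{2δ|p − q|₁}` (`0 ≤ δ`). -/
theorem biLoc_swap_pts {K : MKer 4 Unit} {p q : Fin 4 → ℤ} {C δ : ℝ} (hK : BiLoc K q p C δ) (hδ : 0 ≤ δ) :
    BiLoc K p q (C * Real.exp (2 * δ * l1 (p - q))) δ := by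
  intro x y a b
  refine (hK x y a b).trans ?_
  have hC : 0 ≤ C := hK.nonneg a
  have hx : l1 (x - p) ≤ l1 (x - q) + l1 (p - q) := by
    have h := l1_add_le (x - q) (q - p); rw [sub_add_sub_cancel] at h; rwa [Beta.l1_sub_comm p q]
  have hy : l1 (y - q) ≤ l1 (y - p) + l1 (p - q) := by
    have h := l1_add_le (y - p) (p - q); rwa [sub_add_sub_cancel] at h
  rw [mul_assoc, ← Real.exp_add]
  exact mul_le_mul_of_nonneg_left (Real.exp_le_exp.mpr (by nlinarith)) hC

/-- [our object] The localisation constant of one cross product (rate `1/2`). -/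
def cC : ℝ := (Fintype.card Unit : ℝ) * (Real.exp (1 / 2) * (Real.exp (2 * (1 / 2)) + Real.exp (1 / 2))) * Zl 4 (1 / 2 / 2)

/-- [our object] The localisation constant of one current-current product (rate `1/2`). -/
def cJ : ℝ := (Fintype.card Unit : ℝ) * (Real.exp (1 / 2) * Real.exp (1 / 2)) * Zl 4 (1 / 2 / 2)

/-- [our object] The localisation constant of the diagonal part of `Xgh₂` (rate `1/2`). -/
def cD : ℝ := (Fintype.card Unit : ℝ) * ((Real.exp 1 + Real.exp 1) * (16 * Real.exp 1)) * Zl 4 (1 - 1 / 2)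
  + (Fintype.card Unit : ℝ) * (16 * Real.exp 1 * (Real.exp (2 * 1) + Real.exp 1)) * Zl 4 (1 - 1 / 2)

/-- [our object] The localisation constant of the diagonal part of `Lgh₂` (rate `1/2`). -/
def cD' : ℝ := (Fintype.card Unit : ℝ) * ((Real.exp 1 + Real.exp 1) * (16 * Real.exp 1)) * Zl 4 (1 - 1 / 2)
  + (Fintype.card Unit : ℝ) * (16 * Real.exp 1 * (Real.exp 1 + Real.exp 1)) * Zl 4 (1 - 1 / 2)

/-- [folklore] A product `K ∘ K′` of kernels bi-localised at `(v, v)` and `(v′, v′)` (rate `1/2`) is bi-localised at `(v, v′)` uniformly in the pair (the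
factor `e^{−|v − v′|₁/4} ≤ 1` is discarded). -/
theorem biLoc_cross {K K' : MKer 4 Unit} {v v' : Fin 4 → ℤ} {C C' : ℝ} (hK : BiLoc K v v C (1 / 2)) (hK' : BiLoc K' v' v' C' (1 / 2)) :
    BiLoc (comp K K') v v' ((Fintype.card Unit : ℝ) * (C * C') * Zl 4 (1 / 2 / 2)) (1 / 2) := by
  have h := biLoc_comp_biLoc hK hK' (by norm_num : (0 : ℝ) < 1 / 2)
  refine StepJetData.biLoc_weaken h ?_ le_rfl
  have hC : 0 ≤ (Fintype.card Unit : ℝ) * (C * C') * Zl 4 (1 / 2 / 2) :=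
    mul_nonneg (mul_nonneg (Nat.cast_nonneg _) (mul_nonneg (hK.nonneg ()) (hK'.nonneg ()))) (ExpKernelCalculus.Zl_pos (by norm_num)).le
  have he : Real.exp (-(1 / 2 / 2) * l1 (v - v')) ≤ 1 := Real.exp_le_one_iff.mpr (by have := l1_nonneg (v - v'); nlinarith)
  exact (mul_le_mul_of_nonneg_left he hC).trans_eq (mul_one _)

/-- [folklore] `BiLoc (ghCur_β ∘ etD_β′) u u′ cC (1/2)`. -/
theorem biLoc_cur_etD : BiLoc (comp (ghCur κ u) (etD l u')) u u' cC (1 / 2) := biLoc_cross (biLoc_ghCur κ u (1 / 2)) (biLoc_etD l u' (1 / 2))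

/-- [folklore] `BiLoc (ghCur_β ∘ ghCur_β′) u u′ cJ (1/2)`. -/
theorem biLoc_cur_cur : BiLoc (comp (ghCur κ u) (ghCur l u')) u u' cJ (1 / 2) := biLoc_cross (biLoc_ghCur κ u (1 / 2)) (biLoc_ghCur l u' (1 / 2))

/-- [folklore] `BiLoc (gh₂ ∘ lapU) u u _ (1/2)`. -/
theorem biLoc_gh₂_lapU : BiLoc (comp (gh₂ κ u) lapU) u u ((Fintype.card Unit : ℝ) * ((Real.exp 1 + Real.exp 1) * (16 * Real.exp 1)) * Zl 4 (1 - 1 / 2)) (1 / 2) :=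
  biLoc_comp_right (biLoc_gh₂ κ u 1) decays_lapU (by norm_num) (by norm_num)

/-- [folklore] `BiLoc (lapU ∘ gh₂) u u _ (1/2)`. -/
theorem biLoc_lapU_gh₂ : BiLoc (comp lapU (gh₂ κ u)) u u ((Fintype.card Unit : ℝ) * (16 * Real.exp 1 * (Real.exp 1 + Real.exp 1)) * Zl 4 (1 - 1 / 2)) (1 / 2) :=
  biLoc_comp_decays decays_lapU (biLoc_gh₂ κ u 1) (by norm_num) (by norm_num)

/-- [folklore] `BiLoc (lapU ∘ etD) u u _ (1/2)`. -/
theorem biLoc_lapU_etD : BiLoc (comp lapU (etD κ u)) u u ((Fintype.card Unit : ℝ) * (16 * Real.exp 1 * (Real.exp (2 * 1) + Real.exp 1)) * Zl 4 (1 - 1 / 2)) (1 / 2) :=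
  biLoc_comp_decays decays_lapU (biLoc_etD κ u 1) (by norm_num) (by norm_num)

/-- [folklore] **LOCALISATION SOCKET** of `Xgh₂`: `BiLoc (Xgh₂ κ u l u′) u u′ (cD + (cC + cC·e^{|u − u′|₁})) (1/2)` — ONE common rate (hypothesis `hW` of
`tendsto_hessT_hessKer`; the constant is explicit in the pair). -/
theorem biLoc_Xgh₂ : BiLoc (Xgh₂ κ u l u') u u' (cD + (cC + cC * Real.exp (2 * (1 / 2) * l1 (u - u')))) (1 / 2) := by
  unfold Xgh₂
  refine biLoc_sub ?_ (biLoc_add (biLoc_cur_etD κ u l u') (biLoc_swap_pts (biLoc_cur_etD l u' κ u) (by norm_num)))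
  by_cases h : u = u' ∧ κ = l
  · rw [if_pos h, ← h.1]
    exact biLoc_add (biLoc_gh₂_lapU κ u) (biLoc_lapU_etD κ u)
  · rw [if_neg h]
    refine biLoc_zero_of_nonneg u u' ?_ _
    have hZ : 0 ≤ Zl 4 (1 - 1 / 2) := (ExpKernelCalculus.Zl_pos (by norm_num)).le
    unfold cD; positivity

/-- [folklore] **LOCALISATION SOCKET** of `Lgh₂`: `BiLoc (Lgh₂ κ u l u′) u u′ (cD′ + (cJ + cJ·e^{|u − u′|₁})) (1/2)`. -/
theorem biLoc_Lgh₂ : BiLoc (Lgh₂ κ u l u') u u' (cD' + (cJ + cJ * Real.exp (2 * (1 / 2) * l1 (u - u')))) (1 / 2) := by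
  unfold Lgh₂
  refine biLoc_add ?_ (biLoc_add (biLoc_cur_cur κ u l u') (biLoc_swap_pts (biLoc_cur_cur l u' κ u) (by norm_num)))
  by_cases h : u = u' ∧ κ = l
  · rw [if_pos h, ← h.1]
    exact biLoc_add (biLoc_gh₂_lapU κ u) (biLoc_lapU_gh₂ κ u)
  · rw [if_neg h]
    refine biLoc_zero_of_nonneg u u' ?_ _
    have hZ : 0 ≤ Zl 4 (1 - 1 / 2) := (ExpKernelCalculus.Zl_pos (by norm_num)).le
    unfold cD'; positivity

/-- [folklore] `shiftK` passes through a test. -/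
theorem shiftK_ite (v : Fin 4 → ℤ) (P : Prop) [Decidable P] (K : MKer 4 Unit) :
    shiftK v (if P then K else 0) = if P then shiftK v K else 0 := by
  split_ifs <;> rfl

/-- [folklore] **COVARIANCE** of `gh₂`: `gh₂ κ (u + v) = shiftK (−v) (gh₂ κ u)`. -/
theorem gh₂_translate (v : Fin 4 → ℤ) : gh₂ κ (u + v) = shiftK (-v) (gh₂ κ u) := by
  rw [gh₂, gh₂, add_right_comm u v (unitVec κ), ptPair_translate, ptPair_translate]; rfl

/-- [folklore] **JOINT COVARIANCE** of `Xgh₂`: `Xgh₂ κ (u + v) l (u′ + v) = shiftK (−v) (Xgh₂ κ u l u′)`. -/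
theorem Xgh₂_translate (v : Fin 4 → ℤ) : Xgh₂ κ (u + v) l (u' + v) = shiftK (-v) (Xgh₂ κ u l u') := by
  rw [Xgh₂, Xgh₂, shiftK_sub, shiftK_add, shiftK_ite, shiftK_add, ← comp_shiftK, ← comp_shiftK, ← comp_shiftK, ← comp_shiftK, shiftK_lapU,
    ← gh₂_translate, ← etD_translate, ← etD_translate, ← ghCur_translate, ← ghCur_translate]
  simp only [add_left_inj]

/-- [folklore] **JOINT COVARIANCE** of `Lgh₂`. -/
theorem Lgh₂_translate (v : Fin 4 → ℤ) : Lgh₂ κ (u + v) l (u' + v) = shiftK (-v) (Lgh₂ κ u l u') := by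
  rw [Lgh₂, Lgh₂, shiftK_add, shiftK_add, shiftK_ite, shiftK_add, ← comp_shiftK, ← comp_shiftK, ← comp_shiftK, ← comp_shiftK, shiftK_lapU,
    ← gh₂_translate, ← ghCur_translate, ← ghCur_translate]
  simp only [add_left_inj]

end Stencils

end Summit.QuantumFields.BalabanUV.Beta.D1BFx.TorusGhostPairStencils

end
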